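/-
Origin: expansion seat `planner-pub-hodgecm-toy-g2-0`, handover #28 2026-08-18T09:24:22Z (`HOME/pub-hodgecm-toy-g2/lean/ToyG2/GradedComm.lean`, md5 9b07e6cf, 117 lines);
landed by the gen-7 packager in gate run 27 as `HodgeCM/Model/ToyG2/GradedComm.lean` (import ^import ToyG2\.→import HodgeCM.Model.ToyG2. ×1).
-/
/-
# HodgeCM.Model.ToyG2.GradedComm — graded commutativity of the exterior algebra and the Künneth interchange law

Generation 2 of the `pub-hodgecm-toy` lineage (seat `planner-pub-hodgecm-toy-g2-0`), DESIGN.md §9·RECIPE (infrastructure for generation 3).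

`mul_comm_graded`: for `x ∈ ⋀^j M`, `y ∈ ⋀^p M` (inside the exterior algebra) `x * y = (-1)^(j*p) • (y * x)` — Mathlib has only
the degree-one case `ExteriorAlgebra.ι_add_mul_swap`; we induct over decomposables (`ι_mul_ιMulti_comm`, `ιMulti_mul_ιMulti_comm`)
and extend by spans.  Consequences for `H¹(X × Y)`: the **interchange law** `(a ⊠ b) ∧ (c ⊠ d) = (-1)^(j p) • ((a ∧ c) ⊠ (b ∧ d))`
(`kun_mul_kun`, in the exterior algebra, so that no degree casts are needed) and the **trace pairing of Künneth products**
(`trOf_wedge_kun_kun`): `(-1)^(j p) · tr_X(a ∧ c) · tr_Y(b ∧ d)` in complementary bidegrees and `0` otherwise.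
-/
import Mathlib
import Summits.HodgeConjecture.HodgeCM.Model.ToyG2.Bidegree

/-! PORT of `HodgeCM/Model/ToyG2/GradedComm.lean` (HodgeCMPerL run 82) — verbatim mechanical port; provenance in the PORT header line. -/

namespace HodgeCM.ToyG2

open HodgeCM.Toy HodgeCM.Toy.CMPresentation
open Literature.AlgebraicGeometry.Motives
open scoped TensorProduct
open exteriorPower Obj₂

noncomputable section

section Graded

variable {R : Type*} [CommRing R] {M : Type*} [AddCommGroup M] [Module R M]

/-- (Ported verbatim from the HodgeCMPerL package; no docstring in the source.) -/
theorem ι_mul_ι_neg (x y : M) :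
    ExteriorAlgebra.ι R x * ExteriorAlgebra.ι R y = -(ExteriorAlgebra.ι R y * ExteriorAlgebra.ι R x) :=
  eq_neg_of_add_eq_zero_left (ExteriorAlgebra.ι_add_mul_swap x y)

/-- a vector anticommutes past a decomposable `n`-vector up to `(-1)^n` -/
theorem ι_mul_ιMulti_comm (x : M) : ∀ (n : ℕ) (b : Fin n → M),
    ExteriorAlgebra.ι R x * ExteriorAlgebra.ιMulti R n b
      = ((-1 : R) ^ n) • (ExteriorAlgebra.ιMulti R n b * ExteriorAlgebra.ι R x)
  | 0, b => by simp [ExteriorAlgebra.ιMulti_zero_apply]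
  | n + 1, b => by
    rw [ExteriorAlgebra.ιMulti_succ_apply,
      ← mul_assoc (ExteriorAlgebra.ι R x) (ExteriorAlgebra.ι R (b 0)), ι_mul_ι_neg x (b 0), neg_mul,
      mul_assoc (ExteriorAlgebra.ι R (b 0)) (ExteriorAlgebra.ι R x),
      ι_mul_ιMulti_comm x n (Matrix.vecTail b), mul_smul_comm,
      ← mul_assoc (ExteriorAlgebra.ι R (b 0)), pow_succ, mul_neg_one, neg_smul]

/-- decomposable multivectors commute up to the Koszul sign `(-1)^(m n)` -/
theorem ιMulti_mul_ιMulti_comm : ∀ (m : ℕ) (a : Fin m → M) (n : ℕ) (b : Fin n → M),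
    ExteriorAlgebra.ιMulti R m a * ExteriorAlgebra.ιMulti R n b
      = ((-1 : R) ^ (m * n)) • (ExteriorAlgebra.ιMulti R n b * ExteriorAlgebra.ιMulti R m a)
  | 0, a, n, b => by simp [ExteriorAlgebra.ιMulti_zero_apply]
  | m + 1, a, n, b => by
    rw [ExteriorAlgebra.ιMulti_succ_apply,
      mul_assoc (ExteriorAlgebra.ι R (a 0)), ιMulti_mul_ιMulti_comm m (Matrix.vecTail a) n b,
      mul_smul_comm, ← mul_assoc (ExteriorAlgebra.ι R (a 0)), ι_mul_ιMulti_comm (a 0) n b,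
      smul_mul_assoc, smul_smul, mul_assoc (ExteriorAlgebra.ιMulti R n b), add_mul, one_mul, pow_add]

/-- **graded commutativity**: homogeneous elements of degrees `j`, `p` commute up to `(-1)^(j p)` -/
theorem mul_comm_graded {j p : ℕ} {x y : ExteriorAlgebra R M} (hx : x ∈ ⋀[R]^j M) (hy : y ∈ ⋀[R]^p M) :
    x * y = ((-1 : R) ^ (j * p)) • (y * x) := by
  rw [← ExteriorAlgebra.ιMulti_span_fixedDegree] at hx hy
  induction hx using Submodule.span_induction with
  | mem x hx' =>
    obtain ⟨a, rfl⟩ := hx'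
    induction hy using Submodule.span_induction with
    | mem y hy' =>
      obtain ⟨b, rfl⟩ := hy'
      exact ιMulti_mul_ιMulti_comm j a p b
    | zero => simp
    | add y z _ _ hy hz => rw [mul_add, add_mul, smul_add, hy, hz]
    | smul r y _ hy => rw [mul_smul_comm, smul_mul_assoc, hy, smul_comm]
  | zero => simp
  | add x z _ _ hx hz => rw [add_mul, mul_add, smul_add, hx, hz]
  | smul r x _ hx => rw [smul_mul_assoc, mul_smul_comm, hx, smul_comm]

end Graded

/-! ### The interchange law for Künneth products on `H¹(X × Y)` -/

/-- `(a ⊠ b) · (c ⊠ d) = (-1)^(j p) • ((a ∧ c) ⊠ (b ∧ d))` in the exterior algebra -/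
theorem kun_mul_kun (X Y : Obj₂) {i j p q : ℕ} (a : ⋀[ℚ]^i X.L) (b : ⋀[ℚ]^j Y.L)
    (c : ⋀[ℚ]^p X.L) (d : ⋀[ℚ]^q Y.L) :
    ((kun X Y i j a b : ⋀[ℚ]^(i + j) (X.prod Y).L) : ExteriorAlgebra ℚ (X.prod Y).L)
        * (kun X Y p q c d : ⋀[ℚ]^(p + q) (X.prod Y).L)
      = ((-1 : ℚ) ^ (j * p)) •
        ((kun X Y (i + p) (j + q) (wedge ℚ X.L i p a c) (wedge ℚ Y.L j q b d)
            : ⋀[ℚ]^((i + p) + (j + q)) (X.prod Y).L) : ExteriorAlgebra ℚ (X.prod Y).L) := by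
  simp only [kun_apply, map_wedge, wedge_coe]
  set A : ExteriorAlgebra ℚ (X.prod Y).L := ↑(map i (X.toObj.inlL Y.toObj) a)
  set B : ExteriorAlgebra ℚ (X.prod Y).L := ↑(map j (X.toObj.inrL Y.toObj) b) with hB
  set C : ExteriorAlgebra ℚ (X.prod Y).L := ↑(map p (X.toObj.inlL Y.toObj) c) with hC
  set D : ExteriorAlgebra ℚ (X.prod Y).L := ↑(map q (X.toObj.inrL Y.toObj) d)
  have hBm : B ∈ ⋀[ℚ]^j (X.prod Y).L := by rw [hB]; exact SetLike.coe_mem _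
  have hCm : C ∈ ⋀[ℚ]^p (X.prod Y).L := by rw [hC]; exact SetLike.coe_mem _
  rw [mul_assoc A B, ← mul_assoc B C D, mul_comm_graded hBm hCm, smul_mul_assoc, mul_smul_comm,
    mul_assoc C B D, ← mul_assoc A C]

/-- traces in propositionally equal degrees of elements with the same underlying multivector agree -/
theorem trOf_congr (X : Obj₂) {k k' : ℕ} (h : k = k') {z : ⋀[ℚ]^k X.L} {z' : ⋀[ℚ]^k' X.L}
    (hz : (z : ExteriorAlgebra ℚ X.L) = z') : trOf X k z = trOf X k' z' := by
  subst h
  rw [Subtype.ext hz]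

/-- **the trace pairing of two Künneth products**: `tr_{X×Y}((a ⊠ b) ∧ (c ⊠ d)) = (-1)^(j p) · tr_X(a ∧ c) · tr_Y(b ∧ d)` if the
bidegrees are complementary, and `0` otherwise -/
theorem trOf_wedge_kun_kun (X Y : Obj₂) {i j p q : ℕ} (a : ⋀[ℚ]^i X.L) (b : ⋀[ℚ]^j Y.L)
    (c : ⋀[ℚ]^p X.L) (d : ⋀[ℚ]^q Y.L) :
    trOf (X.prod Y) ((i + j) + (p + q))
        (wedge ℚ (X.prod Y).L (i + j) (p + q) (kun X Y i j a b) (kun X Y p q c d))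
      = (-1 : ℚ) ^ (j * p) *
        (if sdeg X.s X.leaf = i + p ∧ sdeg Y.s Y.leaf = j + q
          then trOf X (i + p) (wedge ℚ X.L i p a c) * trOf Y (j + q) (wedge ℚ Y.L j q b d) else 0) := by
  rw [trOf_congr (X.prod Y) (add_add_add_comm i j p q)
      (z' := ((-1 : ℚ) ^ (j * p)) • kun X Y (i + p) (j + q) (wedge ℚ X.L i p a c) (wedge ℚ Y.L j q b d))
      (by rw [wedge_coe, Submodule.coe_smul, kun_mul_kun]),
    map_smul, trOf_kun, smul_eq_mul]

end

end HodgeCM.ToyG2
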